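import Summits.Parity.GeneralizedHardyLittlewood.Theorems.LeeYangFibresRelativeDimOneMoebiusSplitStubDefs
import Summits.Parity.GeneralizedHardyLittlewood.Theorems.LeeYangFibresRelativeDimOneMoebiusSplitTermBoundAux2
import Summits.Parity.GeneralizedHardyLittlewood.Theorems.LeeYangFibresRelativeDimOneMoebiusSplitTermBoundAux3
import Summits.Parity.GeneralizedHardyLittlewood.Theorems.LeeYangFibresRelativeDimOneMoebiusSplitMoebiusTermBVAux7
import Literature.NumberTheory.Sieve.LinearEquationsInPrimesWTrickExpSum
import Mathlib
import HarnessLib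

/-!
# Route `LeeYangFibres`, crux `RelativeDimOne` (stmt-Parity-14113), line `single-moebius-split`,
# stub `stub_termClassSums` — auxiliary file 4: counting the classes and the final asymptotics

Bookkeeping for the sum over the classes `(d, e)` of the single-Möbius class sums:

* `tcs_prod_moduli` — the moduli `q_i = d_i` (`i > j`), `q_j = e`, `q_i = 1` (`i < j`) have product
  `e ∏_{i>j} d_i`;
* `tcs_count_multiples` — a given `n ≥ 1` is a multiple of the class modulus
  `M₀(d, e) = lcm_i (q_i / gcd(ψ̇_i, q_i))` for at most `L^{k+2} τ(n)^{k+2}` classes (`M₀ ∣ n` forces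
  `q_i ∣ |ψ̇_i| n`, and `τ(|ψ̇_i| n) ≤ |ψ̇_i| τ(n) ≤ L τ(n)`) — the multiplicity hypothesis of
  `sum_inv_moduli_le`;
* `tcs_card_pairs_le`, `tcs_prod_le_rpow_sum` — the number of classes and the size of the tuples;
* `tcs_eventually_small` — the closing real-variable estimate: for `A = k + s + m + 2` the bound
  `(log N)^k · 2 log(2LN) (2(c log N)^s + 1)/((θ/2) log N)^A · (4N L^{k+2}(1 + log(2LN²))^m + 2L N^{1−θ})`
  is `≤ ε N` for all large `N` (with the tree's `WTrick.eventually_nat_le_log`).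
-/

noncomputable section

open scoped BigOperators Classical Pointwise
open Finset Filter Literature.NumberTheory.Sieve

namespace Summit.Parity.GeneralizedHardyLittlewood.Cruxes.RelativeDimOne.SingleMoebiusSplit

/-! ### The moduli of a class -/

/-- The moduli `q_i = d_i` (`i > j`), `q_j = e`, `q_i = 1` (`i < j`) have product `e ∏_{i > j} d_i`. -/
theorem tcs_prod_moduli {k : ℕ} (j : Fin (k + 1)) (d q : Fin (k + 1) → ℕ) (e : ℕ)
    (hq : ∀ i, q i = if i ∈ Finset.Ioi j then d i else if i = j then e else 1) :
    ∏ i, q i = e * ∏ i ∈ Finset.Ioi j, d i := by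
  have h1 : ∏ i, q i = ∏ i, ((if i ∈ Finset.Ioi j then d i else 1) * (if i = j then e else 1)) := by
    refine Finset.prod_congr rfl fun i _ => ?_
    rw [hq i]
    by_cases hi : i ∈ Finset.Ioi j
    · have hij : i ≠ j := fun h => by rw [h] at hi; exact lt_irrefl j (Finset.mem_Ioi.mp hi)
      rw [if_pos hi, if_pos hi, if_neg hij, mul_one]
    · rw [if_neg hi, if_neg hi, one_mul]
  rw [h1, Finset.prod_mul_distrib, Finset.prod_ite_mem, Finset.univ_inter, Finset.prod_ite_eq']
  simp [mul_comm]

/-! ### Multiplicities of the class moduli -/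

/-- `τ(a n) ≤ a τ(n)` for `a ≥ 1` (`τ` is sub-multiplicative and `τ(a) ≤ a`). -/
theorem tcs_card_divisors_mul_le (a n : ℕ) :
    (a * n).divisors.card ≤ a * n.divisors.card :=
  calc (a * n).divisors.card = (a.divisors * n.divisors).card := by rw [Nat.divisors_mul]
    _ ≤ a.divisors.card * n.divisors.card := Finset.card_mul_le
    _ ≤ a * n.divisors.card := Nat.mul_le_mul_right _ (Nat.card_divisors_le_self a)

/-- **Multiplicity of the class moduli.** For a non-degenerate `Ψ` with `‖Ψ‖_N ≤ L` and `n ≥ 1`, the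
classes `(e, d)` (`e ≤ E`, `1 ≤ d_i ≤ B_i` for `i > j`, `d_i = 1` otherwise) whose modulus
`M₀ = lcm_i (q_i / gcd(ψ̇_i, q_i))` divides `n` number at most `L^{k+2} τ(n)^{k+2}`: `M₀ ∣ n` forces
`e ∣ |ψ̇_j| n` and `d_i ∣ |ψ̇_i| n` (`dvd_natAbs_mul_of_lcm_dvd`), and `τ(|ψ̇_i| n) ≤ L τ(n)`. -/
theorem tcs_count_multiples {k : ℕ} (j : Fin (k + 1)) {Ψ : Fin (k + 1) → AffLinForm 1}
    (hΨ : IsNondegenerateSystem Ψ) {N L : ℕ} (hN : 1 ≤ N) (hsize : affLinSize Ψ N ≤ L) (E : ℕ)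
    (B : Fin (k + 1) → ℕ) (Q : ℕ × (Fin (k + 1) → ℕ) → Fin (k + 1) → ℕ)
    (hQ : ∀ p i, Q p i = if i ∈ Finset.Ioi j then p.2 i else if i = j then p.1 else 1)
    {n : ℕ} (hn : 1 ≤ n) :
    (((((Finset.Icc 1 E) ×ˢ Fintype.piFinset (fun i : Fin (k + 1) =>
        if i ∈ Finset.Ioi j then Finset.Icc 1 (B i) else {1})).filter
        (fun p => Finset.univ.lcm (fun i => Q p i / Int.gcd ((Ψ i).coeff 0) (Q p i)) ∣ n)).card : ℕ)
          : ℝ) ≤ (L : ℝ) ^ (k + 2) * (n.divisors.card : ℝ) ^ (k + 2) := by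
  set a : Fin (k + 1) → ℤ := fun i => (Ψ i).coeff 0 with ha
  have ha0 : ∀ i, a i ≠ 0 := fun i => coeff_zero_ne_zero hΨ i
  have haL : ∀ i, (a i).natAbs ≤ L := fun i => (natAbs_le_of_affLinSize_le hN hsize i).1
  have hn0 : n ≠ 0 := by omega
  have han0 : ∀ i, (a i).natAbs * n ≠ 0 := fun i =>
    mul_ne_zero (Int.natAbs_ne_zero.mpr (ha0 i)) hn0
  have hτ : ∀ i, ((a i).natAbs * n).divisors.card ≤ L * n.divisors.card := fun i =>
    (tcs_card_divisors_mul_le _ _).trans (Nat.mul_le_mul_right _ (haL i))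
  have hjj : j ∉ Finset.Ioi j := fun h => lt_irrefl j (Finset.mem_Ioi.mp h)
  -- the multiples sit inside a product of divisor sets
  have hsub : ((Finset.Icc 1 E) ×ˢ Fintype.piFinset (fun i : Fin (k + 1) =>
        if i ∈ Finset.Ioi j then Finset.Icc 1 (B i) else {1})).filter
        (fun p => Finset.univ.lcm (fun i => Q p i / Int.gcd ((Ψ i).coeff 0) (Q p i)) ∣ n) ⊆
      ((a j).natAbs * n).divisors ×ˢ Fintype.piFinset (fun i : Fin (k + 1) =>
        if i ∈ Finset.Ioi j then ((a i).natAbs * n).divisors else {1}) := by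
    intro p hp
    rw [Finset.mem_filter, Finset.mem_product, Fintype.mem_piFinset] at hp
    obtain ⟨⟨-, hd⟩, hdvd⟩ := hp
    have hall : ∀ i, Q p i ∣ (a i).natAbs * n := fun i => dvd_natAbs_mul_of_lcm_dvd a (Q p) hdvd i
    rw [Finset.mem_product, Fintype.mem_piFinset]
    constructor
    · have h := hall j
      rw [hQ, if_neg hjj, if_pos rfl] at h
      exact Nat.mem_divisors.mpr ⟨h, han0 j⟩
    · intro i
      by_cases hi : i ∈ Finset.Ioi j
      · rw [if_pos hi]
        have h := hall i
        rw [hQ, if_pos hi] at h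
        exact Nat.mem_divisors.mpr ⟨h, han0 i⟩
      · rw [if_neg hi]
        have h := hd i
        rwa [if_neg hi] at h
  -- count the product
  have hcard : (((a j).natAbs * n).divisors ×ˢ Fintype.piFinset (fun i : Fin (k + 1) =>
        if i ∈ Finset.Ioi j then ((a i).natAbs * n).divisors else {1})).card ≤
      (L * n.divisors.card) ^ (k + 2) := by
    rw [Finset.card_product, Fintype.card_piFinset]
    have h1 : ∏ i, (if i ∈ Finset.Ioi j then ((a i).natAbs * n).divisors else {1}).card ≤
        ∏ _i : Fin (k + 1), (L * n.divisors.card) := by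
      refine Finset.prod_le_prod (fun _ _ => Nat.zero_le _) fun i _ => ?_
      split_ifs
      · exact hτ i
      · rw [Finset.card_singleton]
        have hL1 : 1 ≤ L := le_trans (Nat.one_le_iff_ne_zero.mpr (Int.natAbs_ne_zero.mpr (ha0 j)))
          (haL j)
        have hτ1 : 1 ≤ n.divisors.card := Finset.card_pos.mpr ⟨1, Nat.one_mem_divisors.mpr hn0⟩
        exact Nat.mul_le_mul hL1 hτ1
    rw [Finset.prod_const, Finset.card_univ, Fintype.card_fin] at h1
    calc _ ≤ (L * n.divisors.card) * (L * n.divisors.card) ^ (k + 1) := Nat.mul_le_mul (hτ j) h1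
      _ = (L * n.divisors.card) ^ (k + 2) := by ring
  have h := (Finset.card_le_card hsub).trans hcard
  have h' : (((((Finset.Icc 1 E) ×ˢ Fintype.piFinset (fun i : Fin (k + 1) =>
        if i ∈ Finset.Ioi j then Finset.Icc 1 (B i) else {1})).filter
        (fun p => Finset.univ.lcm (fun i => Q p i / Int.gcd ((Ψ i).coeff 0) (Q p i)) ∣ n)).card : ℕ)
          : ℝ) ≤ (((L * n.divisors.card) ^ (k + 2) : ℕ) : ℝ) := by exact_mod_cast h
  refine h'.trans_eq ?_
  push_cast
  ring

/-! ### The number of classes and the size of the tuples -/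

/-- The number of classes: `#([1, E] × {d}) ≤ E · ∏_{i > j} B_i`. -/
theorem tcs_card_pairs_le {k : ℕ} (j : Fin (k + 1)) (E : ℕ) (B : Fin (k + 1) → ℕ) :
    ((((Finset.Icc 1 E) ×ˢ Fintype.piFinset (fun i : Fin (k + 1) =>
        if i ∈ Finset.Ioi j then Finset.Icc 1 (B i) else {1})).card : ℕ) : ℝ) ≤
      (E : ℝ) * ∏ i ∈ Finset.Ioi j, (B i : ℝ) := by
  rw [Finset.card_product, Fintype.card_piFinset, Nat.card_Icc, Nat.add_sub_cancel]
  have h : ∏ i, (if i ∈ Finset.Ioi j then Finset.Icc 1 (B i) else {1}).card =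
      ∏ i ∈ Finset.Ioi j, B i := by
    rw [← Finset.prod_filter_mul_prod_filter_not Finset.univ (fun i => i ∈ Finset.Ioi j)]
    have h1 : ∏ i ∈ Finset.univ.filter (fun i => i ∈ Finset.Ioi j),
        (if i ∈ Finset.Ioi j then Finset.Icc 1 (B i) else {1}).card = ∏ i ∈ Finset.Ioi j, B i := by
      rw [Finset.filter_univ_mem]
      refine Finset.prod_congr rfl fun i hi => ?_
      rw [if_pos hi, Nat.card_Icc, Nat.add_sub_cancel]
    have h2 : ∏ i ∈ Finset.univ.filter (fun i => ¬ i ∈ Finset.Ioi j),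
        (if i ∈ Finset.Ioi j then Finset.Icc 1 (B i) else {1}).card = 1 :=
      Finset.prod_eq_one fun i hi => by
        rw [if_neg (Finset.mem_filter.mp hi).2, Finset.card_singleton]
    rw [h1, h2, mul_one]
  rw [h]
  push_cast
  exact le_rfl

/-- Tuples below the levels: if `x_i ≤ N^{δ_i}` for `i > j` then `∏_{i>j} x_i ≤ N^{∑_{i>j} δ_i}`. -/
theorem tcs_prod_le_rpow_sum {k : ℕ} (j : Fin (k + 1)) (δ : Fin (k + 1) → ℝ) {N : ℕ} (hN : 1 ≤ N)
    (x : Fin (k + 1) → ℝ) (hx0 : ∀ i ∈ Finset.Ioi j, 0 ≤ x i)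
    (hx : ∀ i ∈ Finset.Ioi j, x i ≤ (N : ℝ) ^ (δ i)) :
    ∏ i ∈ Finset.Ioi j, x i ≤ (N : ℝ) ^ (∑ i ∈ Finset.Ioi j, δ i) := by
  have hN0 : (0 : ℝ) < N := by exact_mod_cast hN
  rw [Real.rpow_sum_of_pos hN0]
  exact Finset.prod_le_prod hx0 hx

/-! ### The closing real-variable estimate -/

/-- `c ≤ N^θ` for all large `N` (`θ > 0`). -/
theorem tcs_eventually_le_rpow (c : ℝ) {θ : ℝ} (hθ : 0 < θ) :
    ∀ᶠ N : ℕ in atTop, c ≤ (N : ℝ) ^ θ :=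
  ((tendsto_rpow_atTop hθ).comp tendsto_natCast_atTop_atTop).eventually_ge_atTop c

/-- **The closing estimate** (registered sub-goal for `stub_termClassSums`). For `θ > 0`, `ε > 0`,
`L ≥ 1`, `c ≥ 0` and the saving `A = k + s + m + 2`, for all large `N`:
`(log N)^k · [2 log(2LN) (2(c log N)^s + 1)/((θ/2) log N)^A] · [2N · 2L^{k+2}(1 + log(2LN·N))^m
+ 2L N^{1−θ}] ≤ ε N` — the first product loses one logarithm against `A`, the second a power `N^θ`. -/
theorem tcs_eventually_small : ∀ (k s m : ℕ) (θ ε Lr c : ℝ), 0 < θ → 0 < ε → 1 ≤ Lr → 0 ≤ c →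
    ∀ᶠ N : ℕ in Filter.atTop,
      Real.log N ^ k * (2 * Real.log (2 * Lr * N) *
        ((2 * (c * Real.log N) ^ s + 1) / (θ / 2 * Real.log N) ^ (k + s + m + 2))) *
        (2 * N * (2 * Lr ^ (k + 2) * (1 + Real.log (2 * Lr * N * N)) ^ m) +
          2 * Lr * (N : ℝ) ^ (1 - θ)) ≤ ε * N := by
  intro k s m θ ε Lr c hθ hε hL hc
  -- constants
  set c₁ : ℝ := max c 1 with hc₁
  have hc₁1 : 1 ≤ c₁ := le_max_right _ _
  have hcc₁ : c ≤ c₁ := le_max_left _ _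
  set K₁ : ℝ := 48 * c₁ ^ s * Lr ^ (k + 2) * 4 ^ m / (θ / 2) ^ (k + s + m + 2) with hK₁
  set K₂ : ℝ := 24 * c₁ ^ s * Lr / (θ / 2) ^ (k + s + m + 2) with hK₂
  have hθ2 : 0 < θ / 2 := by positivity
  have hK₁0 : 0 < K₁ := by positivity
  have hK₂0 : 0 < K₂ := by positivity
  filter_upwards [WTrick.eventually_nat_le_log (2 * K₁ / ε), WTrick.eventually_nat_le_log 1,
    tcs_eventually_le_rpow (2 * K₂ / ε) hθ,
    tendsto_natCast_atTop_atTop.eventually_ge_atTop (2 * Lr)] with N h1 h2 h3 h4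
  set ℓ : ℝ := Real.log N with hℓ
  have hℓ1 : 1 ≤ ℓ := h2
  have hℓ0 : 0 < ℓ := by linarith
  have hN2 : (2 : ℝ) ≤ N := by linarith
  have hN0 : (0 : ℝ) < N := by linarith
  have hNθ : 0 < (N : ℝ) ^ θ := Real.rpow_pos_of_pos hN0 θ
  -- the logarithms
  have hlog1 : Real.log (2 * Lr * N) ≤ 2 * ℓ := by
    have h : (2 * Lr * N : ℝ) ≤ N * N := by nlinarith
    calc Real.log (2 * Lr * N) ≤ Real.log (N * N) := Real.log_le_log (by positivity) h
      _ = 2 * ℓ := by rw [Real.log_mul hN0.ne' hN0.ne', hℓ]; ring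
  have hlog2 : 1 + Real.log (2 * Lr * N * N) ≤ 4 * ℓ := by
    have h : Real.log (2 * Lr * N * N) = Real.log (2 * Lr * N) + ℓ := by
      rw [Real.log_mul (by positivity) hN0.ne', hℓ]
    rw [h]; linarith
  have hlog1' : 0 ≤ Real.log (2 * Lr * N) := Real.log_nonneg (by nlinarith)
  have hlog2' : 0 ≤ 1 + Real.log (2 * Lr * N * N) := by
    have h5 : (1 : ℝ) ≤ 2 * Lr * N := by nlinarith
    have := Real.log_nonneg (one_le_mul_of_one_le_of_one_le h5 (by linarith : (1 : ℝ) ≤ N))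
    linarith
  -- the singular-series factor
  have hS : 2 * (c * ℓ) ^ s + 1 ≤ 3 * (c₁ ^ s * ℓ ^ s) := by
    have h1 : (c * ℓ) ^ s ≤ c₁ ^ s * ℓ ^ s := by
      rw [← mul_pow]; exact pow_le_pow_left₀ (by positivity) (by nlinarith) s
    have h2 : 1 ≤ c₁ ^ s * ℓ ^ s := by
      rw [← mul_pow]; exact one_le_pow₀ (by nlinarith)
    linarith
  -- the common factor `(log N)^k · 2 log(2LN) (2S+1)/((θ/2) ℓ)^A ≤ 12 c₁^s ℓ^{k+1+s}/((θ/2)^A ℓ^A)`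
  have hden : 0 < (θ / 2 * ℓ) ^ (k + s + m + 2) := by positivity
  have hW : Real.log N ^ k * (2 * Real.log (2 * Lr * N) *
      ((2 * (c * Real.log N) ^ s + 1) / (θ / 2 * Real.log N) ^ (k + s + m + 2))) ≤
      12 * c₁ ^ s * ℓ ^ (k + 1 + s) / ((θ / 2) ^ (k + s + m + 2) * ℓ ^ (k + s + m + 2)) := by
    rw [← hℓ, ← mul_pow]
    rw [show 12 * c₁ ^ s * ℓ ^ (k + 1 + s) / (θ / 2 * ℓ) ^ (k + s + m + 2) =
      ℓ ^ k * (2 * (2 * ℓ) * ((3 * (c₁ ^ s * ℓ ^ s)) / (θ / 2 * ℓ) ^ (k + s + m + 2))) by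
      field_simp; ring]
    refine mul_le_mul_of_nonneg_left ?_ (by positivity)
    refine mul_le_mul (by linarith) (div_le_div_of_nonneg_right hS hden.le) (by positivity)
      (by positivity)
  -- piece 1: the harmonic part loses one logarithm
  have hP1 : 12 * c₁ ^ s * ℓ ^ (k + 1 + s) / ((θ / 2) ^ (k + s + m + 2) * ℓ ^ (k + s + m + 2)) *
      (2 * N * (2 * Lr ^ (k + 2) * (1 + Real.log (2 * Lr * N * N)) ^ m)) ≤ ε / 2 * N := by
    have hm : (1 + Real.log (2 * Lr * N * N)) ^ m ≤ 4 ^ m * ℓ ^ m := by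
      rw [← mul_pow]; exact pow_le_pow_left₀ hlog2' hlog2 m
    calc _ ≤ 12 * c₁ ^ s * ℓ ^ (k + 1 + s) / ((θ / 2) ^ (k + s + m + 2) * ℓ ^ (k + s + m + 2)) *
          (2 * N * (2 * Lr ^ (k + 2) * (4 ^ m * ℓ ^ m))) := by
          refine mul_le_mul_of_nonneg_left ?_ (by positivity)
          refine mul_le_mul_of_nonneg_left ?_ (by positivity)
          exact mul_le_mul_of_nonneg_left hm (by positivity)
      _ = K₁ / ℓ * N := by
          rw [hK₁]
          field_simp
          ring
      _ ≤ ε / 2 * N := by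
          refine mul_le_mul_of_nonneg_right ?_ hN0.le
          rw [div_le_iff₀ hℓ0]
          have : 2 * K₁ ≤ ε * ℓ := by
            have h := (div_le_iff₀ hε).mp h1
            linarith
          linarith
  -- piece 2: the number of classes loses a power
  have hP2 : 12 * c₁ ^ s * ℓ ^ (k + 1 + s) / ((θ / 2) ^ (k + s + m + 2) * ℓ ^ (k + s + m + 2)) *
      (2 * Lr * (N : ℝ) ^ (1 - θ)) ≤ ε / 2 * N := by
    have hpow : ℓ ^ (k + 1 + s) ≤ ℓ ^ (k + s + m + 2) :=
      pow_le_pow_right₀ hℓ1 (by omega)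
    have hNsplit : (N : ℝ) ^ (1 - θ) * (N : ℝ) ^ θ = N := by
      rw [← Real.rpow_add hN0, sub_add_cancel, Real.rpow_one]
    calc _ ≤ 12 * c₁ ^ s * ℓ ^ (k + s + m + 2) / ((θ / 2) ^ (k + s + m + 2) * ℓ ^ (k + s + m + 2)) *
          (2 * Lr * (N : ℝ) ^ (1 - θ)) := by
          refine mul_le_mul_of_nonneg_right ?_ (by positivity)
          refine div_le_div_of_nonneg_right ?_ (by positivity)
          exact mul_le_mul_of_nonneg_left hpow (by positivity)
      _ = K₂ * (N : ℝ) ^ (1 - θ) := by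
          rw [hK₂]
          field_simp
          ring
      _ ≤ ε / 2 * ((N : ℝ) ^ (1 - θ) * (N : ℝ) ^ θ) := by
          rw [show ε / 2 * ((N : ℝ) ^ (1 - θ) * (N : ℝ) ^ θ) =
            (ε / 2 * (N : ℝ) ^ θ) * (N : ℝ) ^ (1 - θ) by ring]
          refine mul_le_mul_of_nonneg_right ?_ (by positivity)
          have h := (div_le_iff₀ hε).mp h3
          linarith
      _ = ε / 2 * N := by rw [hNsplit]
  -- together
  have hB0 : 0 ≤ 2 * N * (2 * Lr ^ (k + 2) * (1 + Real.log (2 * Lr * N * N)) ^ m) +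
      2 * Lr * (N : ℝ) ^ (1 - θ) := by positivity
  calc _ ≤ 12 * c₁ ^ s * ℓ ^ (k + 1 + s) / ((θ / 2) ^ (k + s + m + 2) * ℓ ^ (k + s + m + 2)) *
        (2 * N * (2 * Lr ^ (k + 2) * (1 + Real.log (2 * Lr * N * N)) ^ m) +
          2 * Lr * (N : ℝ) ^ (1 - θ)) := mul_le_mul_of_nonneg_right hW hB0
    _ ≤ ε / 2 * N + ε / 2 * N := by rw [mul_add]; exact add_le_add hP1 hP2
    _ = ε * N := by ring

end Summit.Parity.GeneralizedHardyLittlewood.Cruxes.RelativeDimOne.SingleMoebiusSplit
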